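import Summits.QuantumAdvantage.QuantumAdvantage.Theorems.CounterDialB

/-! # SparsityDialCounterSplitGlue — closes the glue item of the COUNTER-FORM split of `Theses.SparsityDial.DenseGenericLoss3`

Route `route-QuantumAdvantage-SparsityDial` rev 2 (writer decomp-qadv-writer-1 g10, 2026-08-31): the declared residual
D = `DenseGenericLoss3` (stmt-QuantumAdvantage-27656) is SPLIT (lens-2 g21 node «CounterDial», critic 69v52
CLEARED-as-RESIDUAL-SPLIT) into A = `Theses.SparsityDial.CounterLoss3` (stmt-QuantumAdvantage-27008, special, ATTACKABLE) and
B = `Theses.SparsityDial.NonCounterGenericLoss3` (stmt-QuantumAdvantage-27009, residual), with the glue item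
`Theses.SparsityDial.CounterSplitGlue3 : A → B → D` (stmt-QuantumAdvantage-27010). The children are the landed node pieces
`Theorems.CounterDial.CounterLoss3 / NonCounterGenericLoss3` with `StabCounter` / `CounterForm` / `lin` unfolded, so the
landed `Theorems.CounterDial.closes` proves the glue item verbatim; it cannot be cited inside the route file (this module's
import chain contains the route file), hence this standalone closer. Also recorded BY NAME: the `Iff.rfl` junctions of the
children with the node pieces, the exactness of the split at the items, and A's named consequence `FullPaleyCounterLoss3`. -/

set_option linter.dupNamespace false -- D-0017: single-problem summit (Summit.QuantumAdvantage.QuantumAdvantage)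

namespace Summit.QuantumAdvantage.QuantumAdvantage.Theorems.SparsityDial

/-- **closes the glue item stmt-QuantumAdvantage-27010** (`CounterSplitGlue3 : CounterLoss3 → NonCounterGenericLoss3 →
DenseGenericLoss3`): the landed `Theorems.CounterDial.closes` (by cases on the counter-form gauge; `a, C, n₀ := max`). -/
theorem counterSplitGlue3 : Summit.QuantumAdvantage.QuantumAdvantage.Theses.SparsityDial.CounterSplitGlue3 :=
  fun hA hB => Summit.QuantumAdvantage.QuantumAdvantage.Theorems.CounterDial.closes hA hB

/-- junction: the split child A is the node's special piece (`StabCounter` unfolded) — `Iff.rfl`. -/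
theorem counterLoss3_iff_node : Summit.QuantumAdvantage.QuantumAdvantage.Theses.SparsityDial.CounterLoss3 ↔
    Summit.QuantumAdvantage.QuantumAdvantage.Theorems.CounterDial.CounterLoss3 := Iff.rfl

/-- junction: the split child B is the node's generic piece — `Iff.rfl`. -/
theorem nonCounterGenericLoss3_iff_node : Summit.QuantumAdvantage.QuantumAdvantage.Theses.SparsityDial.NonCounterGenericLoss3 ↔
    Summit.QuantumAdvantage.QuantumAdvantage.Theorems.CounterDial.NonCounterGenericLoss3 := Iff.rfl

/-- EXACTNESS of the split at the items: D ↔ A ∧ B (so a refutation of either child refutes D). -/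
theorem denseGenericLoss3_iff_counterSplit : Summit.QuantumAdvantage.QuantumAdvantage.Theses.SparsityDial.DenseGenericLoss3 ↔
    (Summit.QuantumAdvantage.QuantumAdvantage.Theses.SparsityDial.CounterLoss3 ∧
      Summit.QuantumAdvantage.QuantumAdvantage.Theses.SparsityDial.NonCounterGenericLoss3) :=
  Summit.QuantumAdvantage.QuantumAdvantage.Theorems.CounterDial.dense_iff_split

/-- A alone decides the lineage's first undecided named window-counter instance (TREE N101). -/
theorem fullPaleyCounterLoss3_of_counterLoss3 (h : Summit.QuantumAdvantage.QuantumAdvantage.Theses.SparsityDial.CounterLoss3) :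
    Summit.QuantumAdvantage.QuantumAdvantage.Theorems.BlindDial.FullPaleyCounterLoss3 :=
  Summit.QuantumAdvantage.QuantumAdvantage.Theorems.CounterDial.fullPaley_of_counterLoss h

end Summit.QuantumAdvantage.QuantumAdvantage.Theorems.SparsityDial
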